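import Mathlib
import HarnessLib
import Summits.HubbardSuperconductivity.HubbardSuperconductivity.Theorems.KLProgrammeKLRegimeEngineValueClauseReductionV10
import Summits.HubbardSuperconductivity.HubbardSuperconductivity.Theorems.KLProgrammeKLRegimeSplitEngineV10

/-!
# Route `KLProgramme` — crux K3, GEN-6 engine slot `EngineBoundsAtV10S` (bundle `klPredsV15`, rider (R-Dq)): the value-clause reductions on the
# V10 tokens (`legDressBarQ ↦ legDressBarQ2`) — registered stub shapes and the IN-CLASS (E2″-v7) corollary of (E2-v10)
# (cell gate-hubbard-kl, seat hubbard-kl-k3c2-p2 g6 «thermal-bar induction n ≤ nScales β + 1»; value-clause reduction lane `klvr_`/`klvr9_`/`klvr10_`)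

Port of `…EngineValueClauseReductionV9` (klvr9_, V9 tokens) and `…EngineValueClauseReductionV10` (klvr10_, in-class (E2″-v6)) to the gen-6 engine
slot of `…SplitEngineV10` (k3c2-p3 g3; plan g14 (R12) T2): (E2-v10) `PairLadderStepAtV10`, (E2″-v7) `PairValueIncrementAtV7`, (E2′-S4)
`QuarticValueIncrementAtS4`, (E2′-S3 UV) `QuarticValueUVAtS3` differ from their V9/V6/S3/S2 sources by the ONE token `legDressBarQ ↦ legDressBarQ2`
(profile-free leg-dressing majorant), so every reduction transports verbatim:

* §1 `klvr11_quarticValueIncrementAtS4_of_pairValueIncrementAtV7` ((E2′-S4) ⇐ (E2″-v7), klka identity `λ_n^{↑↓}(k₁,k₂,k₃) = 𝒞_n(k₁+k₃;k₂,k₁)`),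
  `klvr11_quarticValueUVAtS3_of_pairLadderStepAtV10`, **`klvr11_stepValuesConj_of_reduced`** (the five-clause conclusion
  `PairLadderStepAtV10 ∧ PairValueIncrementAtV7 ∧ QuarticValueIncrementAtS4 ∧ EngineFirstMoments ∧ IsoTupleL1AtS` of the gen-6 `stub_engine_step_values`
  from FOUR clauses), **`klvr11_scaleZeroConj_of_reduced`** (the `stub_engine_scale0` shape `KernelNormsV4 0 ∧ PairLadderStepAtV10 0 ∧ QuarticValueUVAtS3 0 ∧ …`
  from (E1-v4)₀, the pair-amplitude UV clause, (E4)₀, (E5-S)₀), `klvr11_engineBoundsAtV10S_of_clauses` / `_iff`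
  (`EngineBoundsAtV10S … n ↔ (E1-v4) ∧ (E2-v10) ∧ (E2″-v7) ∧ (E4) ∧ (E5-S)`);
* §2 **`klvr11_pairValueIncrement_inClass_of_ladder`** / **`klvr11_pairValueIncrement_inClass`**: at `n ≥ 1` and `Qm` in the pair class, the (E2″-v7)
  inequality follows from (E2-v10), the history's `PairArrayAtV2 … (n−1)` and the single package inequality `G.aplus·G.ζ(n−1) + 10·G.bhi ≤ G.ppGain n |Qm|_𝕋`
  (`Klam ≥ 1`, `(C_W + klLegKappa·Q.CR·Klam³)|U| ≤ 1/10`, `|U|·bhi ≤ 1/8`) — the matrix algebra is `klvr10_increment_entry_le` unchanged.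

Bookkeeping over the route's predicates; nothing about the model is asserted.
-/

noncomputable section

namespace Summit.HubbardSuperconductivity.HubbardSuperconductivity.Theorems.KLRegimeSplit

set_option linter.dupNamespace false -- summit = problem name (single-conjunct summit), D-0017

open Real Finset Literature.MathematicalPhysics.QuantumLattice Literature.Probability.LatticeModels
open Summit.HubbardSuperconductivity.HubbardSuperconductivity.Theorems.KLProgrammeLegKernels

section Model

variable {L M : ℕ} [NeZero L] [NeZero M]

/-! ## §1 The registered stub shapes on the V10 tokens -/

/-- **(E2′-S4) is a COROLLARY of (E2″-v7)** at every scale (twin of `klvr_quarticValueIncrementAtS3_of_pairValueIncrementAtV6`; the count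
`legSliceCountT` is permutation-invariant, the majorant token is irrelevant). -/
theorem klvr11_quarticValueIncrementAtS4_of_pairValueIncrementAtV7 {G : GeoConsts} {P : SplitConsts} {Q : EngConsts} {β U μ : ℝ}
    {K : TrigPolyC4v} {n : ℕ} (h : PairValueIncrementAtV7 L M G P Q β U μ K n) :
    QuarticValueIncrementAtS4 L M G P Q β U μ K n := by
  intro hn k₁ hk₁ k₂ hk₂ k₃ hk₃
  have h1 := h hn (k₁ + k₃) k₂ hk₂ k₁ hk₁
  rw [klka_quarticValue_eq_pairAmplitude, klka_quarticValue_eq_pairAmplitude]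
  have e1 : k₂ + k₁ - (k₁ + k₃) = k₂ - k₃ := by abel
  have e2 : k₁ + k₃ - k₁ = k₃ := by abel
  have e3 : k₁ + k₃ - k₂ = k₁ - k₂ + k₃ := by abel
  rw [e1, e2, e3, klvr_klTorusNorm_sub_comm k₂ k₁, klvr_legSliceCountT_eq_of_perm_0231] at h1
  exact h1

/-- (E2′-S3 UV) from (E2-v10): the `n = 0` conjuncts coincide. -/
theorem klvr11_quarticValueUVAtS3_of_pairLadderStepAtV10 {G : GeoConsts} {P : SplitConsts} {Q : EngConsts} {β U μ : ℝ} {K : TrigPolyC4v}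
    {n : ℕ} (h : PairLadderStepAtV10 L M G P Q β U μ K n) : QuarticValueUVAtS3 L M G P Q β U μ K n := by
  intro h0
  subst h0
  exact (quarticValueUVAtS3_of_S2
    (klvr9_quarticValueUVAtS2_of_pairLadderStepAtV9 ((pairLadderStepAtV10_iff_V9_zero G P Q β U μ K).1 h))) rfl

/-- **The gen-6 registered stub's shape at the inductive scales** (`stub_engine_step_values` concludes
`PairLadderStepAtV10 … n ∧ PairValueIncrementAtV7 … n ∧ QuarticValueIncrementAtS4 … n ∧ EngineFirstMoments … n ∧ IsoTupleL1AtS … n`): that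
five-clause conjunction from the FOUR clauses without (E2′-S4). -/
theorem klvr11_stepValuesConj_of_reduced {G : GeoConsts} {P : SplitConsts} {Q : EngConsts} {β U μ : ℝ} {K : TrigPolyC4v} {n : ℕ}
    (hE2 : PairLadderStepAtV10 L M G P Q β U μ K n) (hE2'' : PairValueIncrementAtV7 L M G P Q β U μ K n)
    (hE4 : EngineFirstMoments L M G P Q β U μ K n) (hE5 : IsoTupleL1AtS L M G P β U μ K n) :
    PairLadderStepAtV10 L M G P Q β U μ K n ∧ PairValueIncrementAtV7 L M G P Q β U μ K n ∧
      QuarticValueIncrementAtS4 L M G P Q β U μ K n ∧ EngineFirstMoments L M G P Q β U μ K n ∧ IsoTupleL1AtS L M G P β U μ K n :=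
  ⟨hE2, hE2'', klvr11_quarticValueIncrementAtS4_of_pairValueIncrementAtV7 hE2'', hE4, hE5⟩

/-- **The gen-6 registered stub's shape at scale `0`** (`stub_engine_scale0` concludes
`KernelNormsV4 … 0 ∧ PairLadderStepAtV10 … 0 ∧ QuarticValueUVAtS3 … 0 ∧ EngineFirstMoments … 0 ∧ IsoTupleL1AtS … 0`): that five-clause conjunction
from the FOUR analytic clauses (E1-v4)₀, the pair-amplitude ultraviolet clause (stated with the V9 token; `legDressBarQ2 … 0 c = legDressBarQ … 0 c`),
(E4)₀, (E5-S)₀. -/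
theorem klvr11_scaleZeroConj_of_reduced {G : GeoConsts} {P : SplitConsts} {Q : EngConsts} {β U μ : ℝ} {K : TrigPolyC4v}
    (hE1 : KernelNormsV4 L M P Q β U μ K 0)
    (hUV : ∀ Qm : TorusSite 2 L, ∀ k ∈ klBall L μ K, ∀ k' ∈ klBall L μ K,
      ‖klPairAmplitude L M β U μ K 0 Qm k k' - (U : ℂ)‖ ≤ initDevBar G U + legDressBarQ G P Q U 0 4)
    (hE4 : EngineFirstMoments L M G P Q β U μ K 0) (hE5 : IsoTupleL1AtS L M G P β U μ K 0) :
    KernelNormsV4 L M P Q β U μ K 0 ∧ PairLadderStepAtV10 L M G P Q β U μ K 0 ∧ QuarticValueUVAtS3 L M G P Q β U μ K 0 ∧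
      EngineFirstMoments L M G P Q β U μ K 0 ∧ IsoTupleL1AtS L M G P β U μ K 0 := by
  obtain ⟨h1, h2, h3, h4, h5⟩ := klvr9_scaleZeroConj_of_reduced (L := L) (M := M) hE1 hUV hE4 hE5
  exact ⟨h1, (pairLadderStepAtV10_iff_V9_zero G P Q β U μ K).2 h2, quarticValueUVAtS3_of_S2 h3, h4, h5⟩

/-- The same with the ultraviolet clause stated on the V10 token `legDressBarQ2 … 0 4`. -/
theorem klvr11_scaleZeroConj_of_reduced' {G : GeoConsts} {P : SplitConsts} {Q : EngConsts} {β U μ : ℝ} {K : TrigPolyC4v}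
    (hE1 : KernelNormsV4 L M P Q β U μ K 0)
    (hUV : ∀ Qm : TorusSite 2 L, ∀ k ∈ klBall L μ K, ∀ k' ∈ klBall L μ K,
      ‖klPairAmplitude L M β U μ K 0 Qm k k' - (U : ℂ)‖ ≤ initDevBar G U + legDressBarQ2 G P Q U 0 4)
    (hE4 : EngineFirstMoments L M G P Q β U μ K 0) (hE5 : IsoTupleL1AtS L M G P β U μ K 0) :
    KernelNormsV4 L M P Q β U μ K 0 ∧ PairLadderStepAtV10 L M G P Q β U μ K 0 ∧ QuarticValueUVAtS3 L M G P Q β U μ K 0 ∧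
      EngineFirstMoments L M G P Q β U μ K 0 ∧ IsoTupleL1AtS L M G P β U μ K 0 :=
  klvr11_scaleZeroConj_of_reduced hE1 (by simpa only [legDressBarQ2_zero] using hUV) hE4 hE5

/-- **At every scale, (E0), (E2′-S4) and (E2′-S3 UV) are never owed on the V10S slot**: `EngineBoundsAtV10S … n` from the five remaining clauses. -/
theorem klvr11_engineBoundsAtV10S_of_clauses {G : GeoConsts} {P : SplitConsts} {Q : EngConsts} {β U μ : ℝ} {K : TrigPolyC4v} {n : ℕ}
    (hE1 : KernelNormsV4 L M P Q β U μ K n) (hE2 : PairLadderStepAtV10 L M G P Q β U μ K n)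
    (hE2'' : PairValueIncrementAtV7 L M G P Q β U μ K n)
    (hE4 : EngineFirstMoments L M G P Q β U μ K n) (hE5 : IsoTupleL1AtS L M G P β U μ K n) :
    EngineBoundsAtV10S L M G P Q β U μ K n :=
  ⟨selfEnergySymmetric_all L M β U μ K n, hE1, hE2, hE2'', klvr11_quarticValueIncrementAtS4_of_pairValueIncrementAtV7 hE2'',
    klvr11_quarticValueUVAtS3_of_pairLadderStepAtV10 hE2, hE4, hE5⟩

/-- **The V10S slot's exact analytic content, all scales**: `EngineBoundsAtV10S … n ↔ (E1-v4) ∧ (E2-v10) ∧ (E2″-v7) ∧ (E4) ∧ (E5-S)`. -/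
theorem klvr11_engineBoundsAtV10S_iff (G : GeoConsts) (P : SplitConsts) (Q : EngConsts) (β U μ : ℝ) (K : TrigPolyC4v) (n : ℕ) :
    EngineBoundsAtV10S L M G P Q β U μ K n ↔
      KernelNormsV4 L M P Q β U μ K n ∧ PairLadderStepAtV10 L M G P Q β U μ K n ∧ PairValueIncrementAtV7 L M G P Q β U μ K n ∧
        EngineFirstMoments L M G P Q β U μ K n ∧ IsoTupleL1AtS L M G P β U μ K n := by
  constructor
  · exact fun h => ⟨h.2.1, h.2.2.1, h.2.2.2.1, h.2.2.2.2.2.2.1, h.2.2.2.2.2.2.2⟩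
  · exact fun h => klvr11_engineBoundsAtV10S_of_clauses h.1 h.2.1 h.2.2.1 h.2.2.2.1 h.2.2.2.2

/-! ## §2 In-class (E2″-v7) from (E2-v10) -/

/-- **In-class (E2″-v7) from (E2-v10), generic form** (twin of `klvr10_pairValueIncrement_inClass_of_ladder`).  At `n ≥ 1` and `Qm` in the pair
class at resolution `n`: from `PairLadderStepAtV10 … n`, `PairArrayAtV2 … (n−1)`, the envelope size `E := 2|U| + (C_W + klLegKappa·Q.CR·Klam³)U²` with
`E·bhi < 1`, and the package inequality `drivePBar(n−1) + E·bhi·(E/(1 − E·bhi)) ≤ (Klam U)²·ppGain n |Qm|_𝕋`, the pair-value increment obeys the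
(E2″-v7) budget at this `Qm`. -/
theorem klvr11_pairValueIncrement_inClass_of_ladder {G : GeoConsts} {P : SplitConsts} {Q : EngConsts} {β U μ : ℝ} {K : TrigPolyC4v}
    {n : ℕ} (hn : 1 ≤ n) (hlad : PairLadderStepAtV10 L M G P Q β U μ K n) (harr : PairArrayAtV2 L M P Q β U μ K (n - 1))
    {Qm : TorusSite 2 L} (hQm : IsPairClassAt L Qm n)
    (hEm : (2 * |U| + (P.C_W + klLegKappa * Q.CR * P.Klam ^ 3) * U ^ 2) * G.bhi < 1)
    (hgain : drivePBar G P U (n - 1) +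
        (2 * |U| + (P.C_W + klLegKappa * Q.CR * P.Klam ^ 3) * U ^ 2) * G.bhi *
          ((2 * |U| + (P.C_W + klLegKappa * Q.CR * P.Klam ^ 3) * U ^ 2) /
            (1 - (2 * |U| + (P.C_W + klLegKappa * Q.CR * P.Klam ^ 3) * U ^ 2) * G.bhi)) ≤
      (P.Klam * U) ^ 2 * G.ppGain n (klTorusNorm L Qm)) :
    ∀ k ∈ klBall L μ K, ∀ k' ∈ klBall L μ K,
      ‖klPairAmplitude L M β U μ K n Qm k k' - klPairAmplitude L M β U μ K (n - 1) Qm k k'‖ ≤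
        gainBar G P U n (klTorusNorm L Qm) (klTorusNorm L (k - k')) (klTorusNorm L (k + k' - Qm)) +
          eremBar G P Q U β L (n - 1) + thermalBar G P U β n +
            legDressBarQ2 G P Q U n (legSliceCountT L β μ K n ![k', Qm - k', Qm - k, k]) := by
  intro k hk k' hk'
  set E : ℝ := 2 * |U| + (P.C_W + klLegKappa * Q.CR * P.Klam ^ 3) * U ^ 2 with hEdef
  set A := klPairArray L M β U μ K (n - 1) Qm with hAdef
  obtain ⟨w, hw1, hw2, N, hN, hb⟩ := hlad.2 hn Qm hQm
  -- the envelope and the truncation of `A`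
  have hE0 : 0 ≤ E := by
    have h := klvr10_pairArray_envelope harr Qm k hk k hk
    exact (norm_nonneg _).trans h
  have hA2 : ∀ p q, q ∉ klBall L μ K → A p q = 0 := fun p q hq => klvr10_klPairArray_zero_snd β U μ K (n - 1) Qm p hq
  have hEnv : ∀ p ∈ klBall L μ K, ∀ q ∈ klBall L μ K, ‖A p q‖ ≤ E := klvr10_pairArray_envelope harr Qm
  -- the ladder correction
  have hcorr := klvr10_increment_entry_le hN hA2 hE0 hEnv hw1 hEm hk k'
  have hAkk : A k k' = klPairAmplitude L M β U μ K (n - 1) Qm k k' := klPairArray_apply_of_mem L M β U μ K (n - 1) Qm hk hk'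
  -- the (E2-v10) step bound
  have hstep := hb k hk k' hk'
  -- assemble
  have htri : ‖klPairAmplitude L M β U μ K n Qm k k' - klPairAmplitude L M β U μ K (n - 1) Qm k k'‖ ≤
      ‖klPairAmplitude L M β U μ K n Qm k k' - (A * N) k k'‖ + ‖(A * N) k k' - A k k'‖ := by
    rw [← hAkk]
    exact norm_sub_le_norm_sub_add_norm_sub _ _ _
  refine htri.trans ?_
  refine (add_le_add hstep hcorr).trans ?_
  unfold gainBar
  nlinarith [hgain]

/-- **In-class (E2″-v7) from (E2-v10), package form** (twin of `klvr10_pairValueIncrement_inClass`).  With `Klam ≥ 1`, the regime smallness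
`(C_W + klLegKappa·Q.CR·Klam³)·|U| ≤ 1/10` and `|U|·G.bhi ≤ 1/8` (`G.bhi ≥ 0`), the single package inequality
**`G.aplus·G.ζ (n−1) + 10·G.bhi ≤ G.ppGain n |Qm|_𝕋`** suffices. -/
theorem klvr11_pairValueIncrement_inClass {G : GeoConsts} {P : SplitConsts} {Q : EngConsts} {β U μ : ℝ} {K : TrigPolyC4v}
    {n : ℕ} (hn : 1 ≤ n) (hlad : PairLadderStepAtV10 L M G P Q β U μ K n) (harr : PairArrayAtV2 L M P Q β U μ K (n - 1))
    {Qm : TorusSite 2 L} (hQm : IsPairClassAt L Qm n) (hK : 1 ≤ P.Klam) (hbhi : 0 ≤ G.bhi)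
    (hcU : 0 ≤ P.C_W + klLegKappa * Q.CR * P.Klam ^ 3) (hcU' : (P.C_W + klLegKappa * Q.CR * P.Klam ^ 3) * |U| ≤ 1 / 10)
    (hUb : |U| * G.bhi ≤ 1 / 8) (hgain : G.aplus * G.ζ (n - 1) + 10 * G.bhi ≤ G.ppGain n (klTorusNorm L Qm)) :
    ∀ k ∈ klBall L μ K, ∀ k' ∈ klBall L μ K,
      ‖klPairAmplitude L M β U μ K n Qm k k' - klPairAmplitude L M β U μ K (n - 1) Qm k k'‖ ≤
        gainBar G P U n (klTorusNorm L Qm) (klTorusNorm L (k - k')) (klTorusNorm L (k + k' - Qm)) +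
          eremBar G P Q U β L (n - 1) + thermalBar G P U β n +
            legDressBarQ2 G P Q U n (legSliceCountT L β μ K n ![k', Qm - k', Qm - k, k]) := by
  set c : ℝ := P.C_W + klLegKappa * Q.CR * P.Klam ^ 3 with hc
  set E : ℝ := 2 * |U| + c * U ^ 2 with hEdef
  have hU0 : 0 ≤ |U| := abs_nonneg U
  have hU2 : U ^ 2 = |U| ^ 2 := (sq_abs U).symm
  -- `E ≤ (21/10)|U|`
  have hEle : E ≤ 21 / 10 * |U| := by
    rw [hEdef, hU2]
    nlinarith [mul_nonneg hcU hU0]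
  have hEge : 0 ≤ E := by rw [hEdef, hU2]; positivity
  -- `E·bhi ≤ 21/80 < 1`, so `1/(1 − E·bhi) ≤ 80/59`
  have hEb : E * G.bhi ≤ 21 / 80 := by
    calc E * G.bhi ≤ 21 / 10 * |U| * G.bhi := mul_le_mul_of_nonneg_right hEle hbhi
      _ = 21 / 10 * (|U| * G.bhi) := by ring
      _ ≤ 21 / 10 * (1 / 8) := mul_le_mul_of_nonneg_left hUb (by norm_num)
      _ = 21 / 80 := by norm_num
  have hEm : E * G.bhi < 1 := by linarith
  have hden : 0 < 1 - E * G.bhi := by linarith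
  -- the correction `E·bhi·E/(1 − E·bhi) ≤ 10·(Klam U)²·bhi`
  have hcorr : E * G.bhi * (E / (1 - E * G.bhi)) ≤ (P.Klam * U) ^ 2 * (10 * G.bhi) := by
    have h1 : E / (1 - E * G.bhi) ≤ E / (59 / 80) := div_le_div_of_nonneg_left hEge (by norm_num) (by linarith)
    have h2 : E * G.bhi * (E / (1 - E * G.bhi)) ≤ E * G.bhi * (E / (59 / 80)) :=
      mul_le_mul_of_nonneg_left h1 (mul_nonneg hEge hbhi)
    refine h2.trans ?_
    have h3 : E * G.bhi * (E / (59 / 80)) = 80 / 59 * E ^ 2 * G.bhi := by ring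
    rw [h3]
    have h4 : E ^ 2 ≤ (21 / 10) ^ 2 * |U| ^ 2 := by
      rw [← mul_pow]; exact pow_le_pow_left₀ hEge hEle 2
    have h5 : |U| ^ 2 ≤ (P.Klam * U) ^ 2 := by
      rw [mul_pow, ← hU2]
      have h1K : (1 : ℝ) ≤ P.Klam ^ 2 := one_le_pow₀ hK
      calc U ^ 2 = 1 * U ^ 2 := (one_mul _).symm
        _ ≤ P.Klam ^ 2 * U ^ 2 := mul_le_mul_of_nonneg_right h1K (sq_nonneg U)
    nlinarith [mul_nonneg (sq_nonneg E) hbhi, mul_nonneg (sq_nonneg (P.Klam * U)) hbhi]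
  -- the drive term `drivePBar(n−1) = aplus·(Klam U)²·ζ(n−1)`
  have hgain' : drivePBar G P U (n - 1) + E * G.bhi * (E / (1 - E * G.bhi)) ≤ (P.Klam * U) ^ 2 * G.ppGain n (klTorusNorm L Qm) := by
    unfold drivePBar
    have hsq : 0 ≤ (P.Klam * U) ^ 2 := sq_nonneg _
    have h := mul_le_mul_of_nonneg_left hgain hsq
    nlinarith
  exact klvr11_pairValueIncrement_inClass_of_ladder hn hlad harr hQm hEm hgain'

end Model

end Summit.HubbardSuperconductivity.HubbardSuperconductivity.Theorems.KLRegimeSplit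

end
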